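import Literature.MathematicalPhysics.QuantumFieldTheory.Balaban1983to89.B6SectADomainsV1
import Literature.MathematicalPhysics.QuantumFieldTheory.Balaban1983to89.B11Eq115Space
import HarnessLib

/-!
# Route `UnitScaleTilt`, crux K1 child «MinimiserStabilityRegPr» (stmt-QuantumFields-19200), leaf V2′ `stub_halvingStep` — PILLAR F3′
# (k-LEVEL FLAT OPERATORS ON THE CUBE SEQUENCE, UV3-NODE §24), FILE 3: **THE LEVEL MAP OF THE F4 PEN'S WEIGHTS IS [B6]'s TERRITORY MAP** —
# for every nested family `D : B6SectADomainsV1.Domains P`, lit-balaban's `B11Eq115Space.levOf` of the domain sequence `j ↦ Ω_j = {x | x ∈ Bʲ(Ω_j^{(j)})}`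
# («the largest j ≤ k with x ∈ Ω_j», [Balaban1985Variational] p. 286) equals `j` EXACTLY when the `j`-block of `x` lies in `Λ_j = Ω_j^{(j)} ∖ Ω_{j+1}^{(j)}`
# ([Balaban1984PropagatorsII] (2.3)–(2.4) «T = ⋃_j Bʲ(Λ_j)»), so the level-weighted sizes (115)/(152) `(L^{j(x)}η)^m` of the F4 pen's per-level files
# (`FlatSmallSolution158CubeSeq.existsUnique_smallSolution158_dom`, weights by `levOf Ω (K−n) b₋`) and the index family `𝔅 = ⋃_j Λ_j` of the k-level
# operators `Q`, `H`, `G̃` (`B6SectAOperatorsV1.BondIdx D`, file 2 `FlatCubeOperators`) speak about THE SAME levels (VET hazard H3 «F1's output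
# level-weighted (152) in the SAME Ω/level letters the cube stubs consume»)

Cell `ym3-torus` (HUMAN RULING D-0037, YM ladder rung R3), seat `ym3-torus-p1` gen 15.  `--supports stmt-QuantumFields-19200 --as helper`; count-neutral;
def-free; general in `D` (the cube sequence `FlatCubeSequence.cubeSeq`/`cubeSet` of file 1, p527555, is the instance of record: its `cubeSet j` agrees with
`{x | D.InOm j x}` for `1 ≤ j ≤ k` by `FlatCubeSequence.inOm_cubeSeq_iff`, hence has the same `levOf` by `levOf_congr_pos` below).

WHAT IS PROVED (sorry-free; axioms standard).  For `D : Domains P`, `x : Site P 0`, `Ω_D := fun j => {x | D.InOm j x}` (`Ω₀ = T`):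
* **`levOf_inOm_eq_iff`**: `levOf Ω_D D.k x = j ↔ D.LamSite j (iterBlockOf j x)` — the level of the weights IS the territory of (2.3)–(2.4);
* `lamSite_levOf_inOm`: `x` lies over `Λ_{j(x)}`; `levOf_inOm_le`; `levOf_inOm_eq_top_iff` (`j(x) = k ↔ x ∈ Ω_k`), `levOf_inOm_eq_zero_iff` (`j(x) = 0 ↔ x ∉ Ω₁`,
  the frozen region `Λ₀`); `levOf_inOm_unique` (= p21's `lamSite_iterBlockOf_unique`, restated through `levOf`);
* **`levOf_congr_pos`**: two domain sequences that agree at the levels `1 ≤ j ≤ k` have the same `levOf … k` (level `0` is the default value) — so a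
  sequence `Ω` with `Ω j = {x | D.InOm j x}` for `1 ≤ j ≤ k` and ANY `Ω 0` (e.g. print's `□₀` instead of `T`) carries the territory levels of `D`.
HONEST SCOPE.  Bookkeeping over p21's `B6SectADomainsV1` and lit-balaban's `levOf`; no analysis; NOT a claim about the mass gap.

References: [Balaban1985Variational] p.286 (the levels of (115)), (152) p.301; [Balaban1984PropagatorsII] (2.3)–(2.4) p.224.
-/

set_option autoImplicit false

namespace Summit.QuantumFields.YangMills.Theorems.FlatCubeLevels

open Literature.MathematicalPhysics.QuantumFieldTheory.Balaban1983to89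
open B6SectADomainsV1 (Domains)
open B5Eq118OneStroke (iterBlockOf)
open B11Eq115Space (levOf)

variable {P : Params} (D : Domains P)

/-- **THE LEVEL OF THE WEIGHTS IS THE TERRITORY**: for the domain sequence `Ω_j = {x | x ∈ Bʲ(Ω_j^{(j)})}` of a nested family `D`,
`levOf Ω D.k x = j` iff the `j`-block of `x` lies in `Λ_j = Ω_j^{(j)} ∖ Ω_{j+1}^{(j)}`. [cite: Balaban1984PropagatorsII, (2.3)-(2.4) p.224; Balaban1985Variational, p.286] -/
theorem levOf_inOm_eq_iff (x : Site P 0) (j : ℕ) :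
    levOf (fun i => {y : Site P 0 | D.InOm i y}) D.k x = j ↔ D.LamSite j (iterBlockOf j x) := by
  classical
  unfold levOf
  rw [Nat.findGreatest_eq_iff]
  simp only [Set.mem_setOf_eq]
  constructor
  · rintro ⟨hjk, hP, hmax⟩
    refine ⟨?_, ?_⟩
    · by_cases hj : j = 0
      · subst hj
        exact D.inOm_zero x
      · exact hP hj
    · rw [D.deep_iterBlockOf_iff]
      intro hdeep
      by_cases hjk' : j + 1 ≤ D.k
      · exact hmax (Nat.lt_succ_self j) hjk' hdeep
      · have hempty : D.Om (j + 1) = ∅ := D.Om_eq_empty (by omega)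
        simp [Domains.InOm, hempty] at hdeep
  · intro h
    refine ⟨D.le_of_lamSite h, fun _ => h.1, fun n hjn hnk hn => ?_⟩
    exact h.2 ((D.deep_iterBlockOf_iff j x).2 (D.inOm_of_le hjn hn))

/-- every fine site lies over the territory of its level: `B^{j(x)}`-block of `x` `∈ Λ_{j(x)}` ((2.4), existence). [cite: Balaban1984PropagatorsII, (2.4) p.224] -/
theorem lamSite_levOf_inOm (x : Site P 0) :
    D.LamSite (levOf (fun i => {y : Site P 0 | D.InOm i y}) D.k x)
      (iterBlockOf (levOf (fun i => {y : Site P 0 | D.InOm i y}) D.k x) x) :=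
  (levOf_inOm_eq_iff D x _).1 rfl

/-- the level is at most `k`. [cite: Balaban1985Variational, p.286] -/
theorem levOf_inOm_le (x : Site P 0) : levOf (fun i => {y : Site P 0 | D.InOm i y}) D.k x ≤ D.k :=
  B11Eq115Space.levOf_le _ _ _

/-- (2.4), uniqueness, through `levOf`: if the `j`-block of `x` lies in `Λ_j` then `j` is the level. [cite: Balaban1984PropagatorsII, (2.4) p.224] -/
theorem levOf_inOm_unique {x : Site P 0} {j : ℕ} (h : D.LamSite j (iterBlockOf j x)) :
    levOf (fun i => {y : Site P 0 | D.InOm i y}) D.k x = j :=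
  (levOf_inOm_eq_iff D x j).2 h

/-- top level: `j(x) = k ↔ x ∈ Ω_k` (`Λ_k = Ω_k^{(k)}`). [cite: Balaban1984PropagatorsII, (2.3) p.224] -/
theorem levOf_inOm_eq_top_iff (x : Site P 0) :
    levOf (fun i => {y : Site P 0 | D.InOm i y}) D.k x = D.k ↔ D.InOm D.k x := by
  rw [levOf_inOm_eq_iff, D.lamSite_top_iff]
  rfl

/-- level zero: `j(x) = 0 ↔ x ∉ Ω₁` — the FROZEN region `Λ₀ = Ω₁ᶜ` ((2.6) «A = B₀ on Λ₀»; for the cube sequence: outside `□₁`).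
[cite: Balaban1984PropagatorsII, (2.3) p.224, (2.6) p.224] -/
theorem levOf_inOm_eq_zero_iff (x : Site P 0) :
    levOf (fun i => {y : Site P 0 | D.InOm i y}) D.k x = 0 ↔ ¬ D.InOm 1 x := by
  rw [levOf_inOm_eq_iff, D.lamSite_zero_iff]
  exact Iff.rfl

/-- **`levOf … k` ONLY READS THE LEVELS `1 ≤ j ≤ k`** (level `0` is the default): two sequences agreeing there have the same level map — so print's
`Ω′₀ = □₀` (F1's reading) and [B6]'s `Ω₀ = T` (the `Domains` convention) give the SAME weights. [cite: Balaban1985Variational, p.286; Balaban1984PropagatorsII, (2.3) p.224] -/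
theorem levOf_congr_pos {ι : Type*} {Ω Ω' : ℕ → Set ι} {k : ℕ} {x : ι} (h : ∀ j, 1 ≤ j → j ≤ k → (x ∈ Ω j ↔ x ∈ Ω' j)) :
    levOf Ω k x = levOf Ω' k x := by
  classical
  obtain ⟨hmk, hPm, hmax⟩ := (Nat.findGreatest_eq_iff (P := fun j => x ∈ Ω' j) (k := k) (m := levOf Ω' k x)).1 rfl
  unfold levOf
  rw [Nat.findGreatest_eq_iff]
  refine ⟨hmk, fun h0 => (h _ (Nat.one_le_iff_ne_zero.2 h0) hmk).2 (hPm h0), fun n hmn hnk hn => ?_⟩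
  exact hmax hmn hnk ((h n (by omega) hnk).1 hn)

/-- Consequently: a sequence `Ω` that reads `D` at the positive levels (`x ∈ Ω j ↔ D.InOm j x` for `1 ≤ j ≤ D.k`, ANY `Ω 0`) has `levOf Ω D.k x = j ↔` the
`j`-block of `x` lies in `Λ_j` — the hypothesis shape by which file 1's `cubeSet` (via `FlatCubeSequence.inOm_cubeSeq_iff`) inherits the territory levels of
`cubeSeq`. [cite: Balaban1984PropagatorsII, (2.3)-(2.4) p.224; Balaban1985Variational, (144) p.300] -/
theorem levOf_eq_iff_lamSite_of_agree {Ω : ℕ → Set (Site P 0)} {x : Site P 0}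
    (h : ∀ j, 1 ≤ j → j ≤ D.k → (x ∈ Ω j ↔ D.InOm j x)) (j : ℕ) :
    levOf Ω D.k x = j ↔ D.LamSite j (iterBlockOf j x) := by
  rw [levOf_congr_pos (Ω' := fun i => {y : Site P 0 | D.InOm i y}) (fun j hj hjk => by simpa using h j hj hjk)]
  exact levOf_inOm_eq_iff D x j

end Summit.QuantumFields.YangMills.Theorems.FlatCubeLevels
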